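import Summits.QuantumFields.YangMills.Theorems.ColdStartUniversalityLatticeLangevinFrameDerivativeTimeRegularity
import HarnessLib

/-!
# Route `ColdStartUniversality` (fixed-cut-off SZZ dynamics, semigroup calculus): TIME-REGULARITY OF THE FRAME DERIVATIVES OF
# THE SEMIGROUP, II — continuity and the derivative `d/dτ W_n(P_τ F)(x) = W_n(P_τ 𝓛F)(x)`

Helper file (seat `ym-line-csu-p1`, g43; `--supports stmt-QuantumFields-24809`).  Sequel of `…FrameDerivativeTimeRegularity` (time-FTC
`W_n g_(τ₂) − W_n g_(τ₁) = ∫ W_n v_σ dσ` for `C¹` representatives `g_τ` of `κ_τ(f∘coords)` and `v_σ` of `κ_σ(𝓛F)`, any realising Markov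
kernel family `κ` of the SU(2) lattice Langevin (SZZ) dynamics at a fixed cut-off):
* ★★ `continuous_frameDeriv_transitionRep` — with one more level (`a₂ ∈ C⁵` representing `𝓛a` on the group, `a ∈ C³_c`), the map
  `σ ↦ W_n v_σ(coords x)` is continuous on `ℝ` (Lipschitz on bounded intervals by the time-FTC one level up and the uniform bound
  `abs_frameDeriv_transitionRep_le`);
* ★★★ `hasDerivAt_frameDeriv_transitionRep` — for `f ∈ C³_c`, `a ∈ C⁵_c` representing `𝓛f`, `a₂ ∈ C⁵` representing `𝓛a`:
  `τ ↦ W_n g_τ(coords x)` is continuous on `ℝ` and has derivative `W_n v_τ(coords x)` at every `τ > 0` (time through `Real.toNNReal`)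
  — the classical `C¹`-in-time regularity of the spatial gradient of `u(τ,·) = P_τF` for `F` in the Dynkin class with two more
  generator levels (`f ∈ C⁷` suffices to produce `a`, `f ∈ C⁹` to produce `a₂`, by the frame form of the generator and a cut-off).
This is the time-regularity used by Bakry–Émery flows with a WEIGHTED carré du champ (sequel files).  THEOREMS ONLY, no definition,
no sorry; [folklore].  HONEST FRAMING: fixed-cut-off semigroup calculus; nothing K-uniform; no crux, rung or summit statement is
proved; the Yang–Mills mass gap is NOT proved.
-/

set_option autoImplicit false

noncomputable section

namespace Summit.QuantumFields.YangMills.Theorems.ColdStartUniversality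

open MeasureTheory ProbabilityTheory Matrix Complex Finset Filter Set Metric
open scoped ComplexConjugate BigOperators Matrix NNReal ENNReal Topology
open Literature.Probability.Process Literature.MathematicalPhysics.QuantumFieldTheory
open Literature.MathematicalPhysics.QuantumLattice (fundamentalRep fundamentalLatticeRep continuous_fundamentalRep fundamentalRep_apply)

variable {L : ℕ} [NeZero L]

/-! ## §1. Continuity in time of the frame derivatives -/

/-- ★★ **Continuity in time of `W_n v_σ(coords x)`.**  Let `a ∈ C³_c`, let `a₂ ∈ C⁵` represent `𝓛a` on the group, and let `v_σ`,
`v₂_σ` be `C¹` representatives of `κ_σ(a∘coords)`, `κ_σ(a₂∘coords)`.  Then `σ ↦ W_n v_σ(coords x)` (time read through `Real.toNNReal`)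
is continuous on `ℝ`: by the time-FTC one level up it is Lipschitz on bounded intervals. [folklore] -/
theorem continuous_frameDeriv_transitionRep (L : ℕ) [NeZero L] (β' : ℝ)
    (κ : ℝ≥0 → Kernel (GaugeConfig 3 L (Matrix.specialUnitaryGroup (Fin 2) ℂ))
      (GaugeConfig 3 L (Matrix.specialUnitaryGroup (Fin 2) ℂ))) [∀ t, IsMarkovKernel (κ t)]
    (hreal : ∀ (t : ℝ≥0) (x : GaugeConfig 3 L (Matrix.specialUnitaryGroup (Fin 2) ℂ))
        (Ω : Type) [MeasurableSpace Ω] (P : Measure Ω) [IsProbabilityMeasure P]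
        (W : ℝ≥0 → Ω → (Edge 3 L × NoiseIdx 2 → ℝ)) (hW : IsFlatBrownian W P)
        (U : ℝ≥0 → Ω → GaugeConfig 3 L (Matrix.specialUnitaryGroup (Fin 2) ℂ)),
        (∀ ω, U 0 ω = x) →
        (latticeLangevinDynamics (fundamentalLatticeRep 2) β').IsSolution (fundamentalRep (Fin 2))
          hW.natFiltration P W U →
        κ t x = P.map (U t))
    {a : (Edge 3 L × Fin 2 × Fin 2 × Bool → ℝ) → ℝ} (ha : ContDiff ℝ 3 a) (hac : HasCompactSupport a)
    {a₂ : (Edge 3 L × Fin 2 × Fin 2 × Bool → ℝ) → ℝ} (ha₂ : ContDiff ℝ 5 a₂)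
    (v v₂ : ℝ≥0 → (Edge 3 L × Fin 2 × Fin 2 × Bool → ℝ) → ℝ) (hv : ∀ τ, ContDiff ℝ 1 (v τ)) (hv₂ : ∀ τ, ContDiff ℝ 1 (v₂ τ))
    (n : Edge 3 L × NoiseIdx (fundamentalLatticeRep 2).N) (x : GaugeConfig 3 L (Matrix.specialUnitaryGroup (Fin 2) ℂ)) :
    let coords : GaugeConfig 3 L (Matrix.specialUnitaryGroup (Fin 2) ℂ) → (Edge 3 L × Fin 2 × Fin 2 × Bool → ℝ) :=
      fun V q => (fun z : ℂ => if q.2.2.2 then z.im else z.re)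
        ((fundamentalRep (Fin 2) (V q.1) : Matrix (Fin 2) (Fin 2) ℂ) q.2.1 q.2.2.1)
    let gen : ((Edge 3 L × Fin 2 × Fin 2 × Bool → ℝ) → ℝ) → GaugeConfig 3 L (Matrix.specialUnitaryGroup (Fin 2) ℂ) → ℝ :=
      fun h V =>
      (∑ i : Edge 3 L × Fin 2 × Fin 2 × Bool, fderiv ℝ h (coords V) (Pi.single i 1) *
          (fun z : ℂ => if i.2.2.2 then z.im else z.re)
            ((latticeLangevinDynamics (fundamentalLatticeRep 2) β').drift
              (matrixConfig (fundamentalRep (Fin 2)) V) i.1 i.2.1 i.2.2.1) +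
      1 / 2 * ∑ i : Edge 3 L × Fin 2 × Fin 2 × Bool, ∑ j : Edge 3 L × Fin 2 × Fin 2 × Bool,
        fderiv ℝ (fun z => fderiv ℝ h z (Pi.single i 1)) (coords V) (Pi.single j 1) *
          ∑ n : Edge 3 L × NoiseIdx 2,
            (if n.1 = i.1 then (fun z : ℂ => if i.2.2.2 then z.im else z.re)
              ((latticeLangevinDynamics (fundamentalLatticeRep 2) β').noise
                (matrixConfig (fundamentalRep (Fin 2)) V) i.1 n.2 i.2.1 i.2.2.1) else 0) *
            (if n.1 = j.1 then (fun z : ℂ => if j.2.2.2 then z.im else z.re)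
              ((latticeLangevinDynamics (fundamentalLatticeRep 2) β').noise
                (matrixConfig (fundamentalRep (Fin 2)) V) j.1 n.2 j.2.1 j.2.2.1) else 0))
    (∀ y, a₂ (coords y) = gen a y) →
    (∀ (τ : ℝ≥0) (y : GaugeConfig 3 L (Matrix.specialUnitaryGroup (Fin 2) ℂ)), ∫ z, a (coords z) ∂(κ τ y) = v τ (coords y)) →
    (∀ (τ : ℝ≥0) (y : GaugeConfig 3 L (Matrix.specialUnitaryGroup (Fin 2) ℂ)), ∫ z, a₂ (coords z) ∂(κ τ y) = v₂ τ (coords y)) →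
    Continuous fun σ : ℝ => fderiv ℝ (v σ.toNNReal) (coords x) (fun q : Edge 3 L × Fin (fundamentalLatticeRep 2).N × Fin (fundamentalLatticeRep 2).N × Bool => if n.1 = q.1 then (fun z : ℂ => if q.2.2.2 then z.im else z.re) (((Real.sqrt 2 : ℂ) • ((fundamentalLatticeRep 2).lieProj (noiseDir n.2) * (fun (ee : Edge 3 L) => Matrix.of fun (i j : Fin (fundamentalLatticeRep 2).N) => ((coords x (ee, i, j, false) : ℝ) : ℂ) + ((coords x (ee, i, j, true) : ℝ) : ℂ) * Complex.I) q.1)) q.2.1 q.2.2.1) else 0) := by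
  intro coords gen haa hvrep hv₂rep
  obtain ⟨Φ, hΦ⟩ : ∃ Φ : ℝ → ℝ, Φ = fun σ : ℝ => fderiv ℝ (v σ.toNNReal) (coords x) (fun q : Edge 3 L × Fin (fundamentalLatticeRep 2).N × Fin (fundamentalLatticeRep 2).N × Bool => if n.1 = q.1 then (fun z : ℂ => if q.2.2.2 then z.im else z.re) (((Real.sqrt 2 : ℂ) • ((fundamentalLatticeRep 2).lieProj (noiseDir n.2) * (fun (ee : Edge 3 L) => Matrix.of fun (i j : Fin (fundamentalLatticeRep 2).N) => ((coords x (ee, i, j, false) : ℝ) : ℂ) + ((coords x (ee, i, j, true) : ℝ) : ℂ) * Complex.I) q.1)) q.2.1 q.2.2.1) else 0) := ⟨_, rfl⟩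
  rw [← hΦ]
  refine continuous_iff_continuousAt.2 fun σ₀ => ?_
  obtain ⟨M, hM0, hM⟩ := abs_frameDeriv_transitionRep_le L β' κ hreal ha₂ (|σ₀| + 1)
  -- Lipschitz estimate on `[0, |σ₀| + 1]`
  have hLip : ∀ s t : ℝ, 0 ≤ s → s ≤ t → t ≤ |σ₀| + 1 → |Φ t - Φ s| ≤ M * (t - s) := by
    intro s t hs hst ht
    have hA := (frameDeriv_transition_sub_eq_integral L β' κ hreal ha hac ha₂ v v₂ hv hv₂ n x hs hst haa hvrep hv₂rep).2
    have e : Φ t - Φ s = ∫ σ in s..t, fderiv ℝ (v₂ σ.toNNReal) (coords x) (fun q : Edge 3 L × Fin (fundamentalLatticeRep 2).N × Fin (fundamentalLatticeRep 2).N × Bool => if n.1 = q.1 then (fun z : ℂ => if q.2.2.2 then z.im else z.re) (((Real.sqrt 2 : ℂ) • ((fundamentalLatticeRep 2).lieProj (noiseDir n.2) * (fun (ee : Edge 3 L) => Matrix.of fun (i j : Fin (fundamentalLatticeRep 2).N) => ((coords x (ee, i, j, false) : ℝ) : ℂ) + ((coords x (ee, i, j, true) : ℝ) : ℂ) * Complex.I)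 q.1)) q.2.1 q.2.2.1) else 0) := by
      rw [hΦ]; exact hA
    rw [e, ← Real.norm_eq_abs, show M * (t - s) = M * |t - s| by rw [abs_of_nonneg (sub_nonneg.2 hst)]]
    refine intervalIntegral.norm_integral_le_of_norm_le_const fun ρ hρ => ?_
    rw [Real.norm_eq_abs]
    have hρ' : 0 ≤ ρ ∧ ρ ≤ t := by
      rcases Set.mem_uIoc.1 hρ with h' | h' <;> constructor <;> linarith [h'.1, h'.2]
    have hρT : ((ρ.toNNReal : ℝ≥0) : ℝ) ≤ |σ₀| + 1 := by
      rw [Real.coe_toNNReal _ hρ'.1]; linarith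
    exact hM ρ.toNNReal hρT (v₂ ρ.toNNReal) (hv₂ _) (fun y => hv₂rep _ y) n x
  -- values at nonpositive times coincide with the value at `0`
  have hneg : ∀ u : ℝ, u ≤ 0 → Φ u = Φ 0 := by
    intro u hu
    rw [hΦ]
    simp only [Real.toNNReal_of_nonpos hu, Real.toNNReal_zero]
  have hLip' : ∀ u w : ℝ, u ≤ w → w ≤ |σ₀| + 1 → |Φ w - Φ u| ≤ M * (w - u) := by
    intro u w huw hw
    rcases le_or_gt 0 u with hu | hu
    · exact hLip u w hu huw hw
    · rcases le_or_gt 0 w with hw0 | hw0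
      · rw [hneg u hu.le]
        have h := hLip 0 w le_rfl hw0 hw
        calc |Φ w - Φ 0| ≤ M * (w - 0) := h
          _ ≤ M * (w - u) := by nlinarith
      · rw [hneg u hu.le, hneg w hw0.le, sub_self, abs_zero]
        nlinarith
  refine Metric.continuousAt_iff.2 fun ε hε => ?_
  refine ⟨min 1 (ε / (M + 1)), lt_min one_pos (by positivity), fun σ hσ => ?_⟩
  have hσ1 : |σ - σ₀| < 1 := lt_of_lt_of_le hσ (min_le_left _ _)
  have hσ2 : |σ - σ₀| < ε / (M + 1) := lt_of_lt_of_le hσ (min_le_right _ _)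
  rw [Real.dist_eq]
  have hbound : |Φ σ - Φ σ₀| ≤ M * |σ - σ₀| := by
    rcases le_total σ σ₀ with h | h
    · rw [abs_sub_comm, abs_of_nonpos (sub_nonpos.2 h), neg_sub]
      exact hLip' σ σ₀ h (by linarith [le_abs_self σ₀])
    · rw [abs_of_nonneg (sub_nonneg.2 h)]
      have : σ ≤ |σ₀| + 1 := by
        have := (abs_lt.1 hσ1).2; linarith [le_abs_self σ₀]
      exact hLip' σ₀ σ h this
  calc |Φ σ - Φ σ₀| ≤ M * |σ - σ₀| := hbound
    _ ≤ M * (ε / (M + 1)) := mul_le_mul_of_nonneg_left hσ2.le hM0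
    _ < ε := by
        rw [mul_div_assoc']
        rw [div_lt_iff₀ (by positivity)]
        nlinarith

/-! ## §2. Differentiability in time of the frame derivatives of the semigroup -/

/-- ★★★ **`τ ↦ W_n(P_τF)(x)` is `C¹` with derivative `W_n(P_τ𝓛F)(x)`.**  Let `f ∈ C³_c`, `a ∈ C⁵_c` with `a∘coords = 𝓛f`,
`a₂ ∈ C⁵` with `a₂∘coords = 𝓛a` on the group, and let `g_τ, v_τ, v₂_τ` be `C¹` representatives of `κ_τ(f∘coords)`, `κ_τ(a∘coords)`,
`κ_τ(a₂∘coords)`.  Then for every frame index `n` and every `x`: `τ ↦ W_n g_τ(coords x)` is continuous on `ℝ` and has derivative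
`W_n v_τ(coords x)` at every `τ > 0` (time read through `Real.toNNReal`). [folklore] -/
theorem hasDerivAt_frameDeriv_transitionRep (L : ℕ) [NeZero L] (β' : ℝ)
    (κ : ℝ≥0 → Kernel (GaugeConfig 3 L (Matrix.specialUnitaryGroup (Fin 2) ℂ))
      (GaugeConfig 3 L (Matrix.specialUnitaryGroup (Fin 2) ℂ))) [∀ t, IsMarkovKernel (κ t)]
    (hreal : ∀ (t : ℝ≥0) (x : GaugeConfig 3 L (Matrix.specialUnitaryGroup (Fin 2) ℂ))
        (Ω : Type) [MeasurableSpace Ω] (P : Measure Ω) [IsProbabilityMeasure P]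
        (W : ℝ≥0 → Ω → (Edge 3 L × NoiseIdx 2 → ℝ)) (hW : IsFlatBrownian W P)
        (U : ℝ≥0 → Ω → GaugeConfig 3 L (Matrix.specialUnitaryGroup (Fin 2) ℂ)),
        (∀ ω, U 0 ω = x) →
        (latticeLangevinDynamics (fundamentalLatticeRep 2) β').IsSolution (fundamentalRep (Fin 2))
          hW.natFiltration P W U →
        κ t x = P.map (U t))
    {f : (Edge 3 L × Fin 2 × Fin 2 × Bool → ℝ) → ℝ} (hf : ContDiff ℝ 3 f) (hfc : HasCompactSupport f)
    {a : (Edge 3 L × Fin 2 × Fin 2 × Bool → ℝ) → ℝ} (ha : ContDiff ℝ 5 a) (hac : HasCompactSupport a)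
    {a₂ : (Edge 3 L × Fin 2 × Fin 2 × Bool → ℝ) → ℝ} (ha₂ : ContDiff ℝ 5 a₂)
    (g v v₂ : ℝ≥0 → (Edge 3 L × Fin 2 × Fin 2 × Bool → ℝ) → ℝ) (hg : ∀ τ, ContDiff ℝ 1 (g τ)) (hv : ∀ τ, ContDiff ℝ 1 (v τ))
    (hv₂ : ∀ τ, ContDiff ℝ 1 (v₂ τ)) (n : Edge 3 L × NoiseIdx (fundamentalLatticeRep 2).N) (x : GaugeConfig 3 L (Matrix.specialUnitaryGroup (Fin 2) ℂ)) :
    let coords : GaugeConfig 3 L (Matrix.specialUnitaryGroup (Fin 2) ℂ) → (Edge 3 L × Fin 2 × Fin 2 × Bool → ℝ) :=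
      fun V q => (fun z : ℂ => if q.2.2.2 then z.im else z.re)
        ((fundamentalRep (Fin 2) (V q.1) : Matrix (Fin 2) (Fin 2) ℂ) q.2.1 q.2.2.1)
    let gen : ((Edge 3 L × Fin 2 × Fin 2 × Bool → ℝ) → ℝ) → GaugeConfig 3 L (Matrix.specialUnitaryGroup (Fin 2) ℂ) → ℝ :=
      fun h V =>
      (∑ i : Edge 3 L × Fin 2 × Fin 2 × Bool, fderiv ℝ h (coords V) (Pi.single i 1) *
          (fun z : ℂ => if i.2.2.2 then z.im else z.re)
            ((latticeLangevinDynamics (fundamentalLatticeRep 2) β').drift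
              (matrixConfig (fundamentalRep (Fin 2)) V) i.1 i.2.1 i.2.2.1) +
      1 / 2 * ∑ i : Edge 3 L × Fin 2 × Fin 2 × Bool, ∑ j : Edge 3 L × Fin 2 × Fin 2 × Bool,
        fderiv ℝ (fun z => fderiv ℝ h z (Pi.single i 1)) (coords V) (Pi.single j 1) *
          ∑ n : Edge 3 L × NoiseIdx 2,
            (if n.1 = i.1 then (fun z : ℂ => if i.2.2.2 then z.im else z.re)
              ((latticeLangevinDynamics (fundamentalLatticeRep 2) β').noise
                (matrixConfig (fundamentalRep (Fin 2)) V) i.1 n.2 i.2.1 i.2.2.1) else 0) *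
            (if n.1 = j.1 then (fun z : ℂ => if j.2.2.2 then z.im else z.re)
              ((latticeLangevinDynamics (fundamentalLatticeRep 2) β').noise
                (matrixConfig (fundamentalRep (Fin 2)) V) j.1 n.2 j.2.1 j.2.2.1) else 0))
    (∀ y, a (coords y) = gen f y) → (∀ y, a₂ (coords y) = gen a y) →
    (∀ (τ : ℝ≥0) (y : GaugeConfig 3 L (Matrix.specialUnitaryGroup (Fin 2) ℂ)), ∫ z, f (coords z) ∂(κ τ y) = g τ (coords y)) →
    (∀ (τ : ℝ≥0) (y : GaugeConfig 3 L (Matrix.specialUnitaryGroup (Fin 2) ℂ)), ∫ z, a (coords z) ∂(κ τ y) = v τ (coords y)) →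
    (∀ (τ : ℝ≥0) (y : GaugeConfig 3 L (Matrix.specialUnitaryGroup (Fin 2) ℂ)), ∫ z, a₂ (coords z) ∂(κ τ y) = v₂ τ (coords y)) →
    (Continuous fun τ : ℝ => fderiv ℝ (g τ.toNNReal) (coords x) (fun q : Edge 3 L × Fin (fundamentalLatticeRep 2).N × Fin (fundamentalLatticeRep 2).N × Bool => if n.1 = q.1 then (fun z : ℂ => if q.2.2.2 then z.im else z.re) (((Real.sqrt 2 : ℂ) • ((fundamentalLatticeRep 2).lieProj (noiseDir n.2) * (fun (ee : Edge 3 L) => Matrix.of fun (i j : Fin (fundamentalLatticeRep 2).N) => ((coords x (ee, i, j, false) : ℝ) : ℂ) + ((coords x (ee, i, j, true) : ℝ) : ℂ) * Complex.I) q.1)) q.2.1 q.2.2.1) else 0)) ∧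
    ∀ τ : ℝ, 0 < τ → HasDerivAt (fun τ : ℝ => fderiv ℝ (g τ.toNNReal) (coords x) (fun q : Edge 3 L × Fin (fundamentalLatticeRep 2).N × Fin (fundamentalLatticeRep 2).N × Bool => if n.1 = q.1 then (fun z : ℂ => if q.2.2.2 then z.im else z.re) (((Real.sqrt 2 : ℂ) • ((fundamentalLatticeRep 2).lieProj (noiseDir n.2) * (fun (ee : Edge 3 L) => Matrix.of fun (i j : Fin (fundamentalLatticeRep 2).N) => ((coords x (ee, i, j, false) : ℝ) : ℂ) + ((coords x (ee, i, j, true) : ℝ) : ℂ) * Complex.I) q.1)) q.2.1 q.2.2.1) else 0))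
      (fderiv ℝ (v τ.toNNReal) (coords x) (fun q : Edge 3 L × Fin (fundamentalLatticeRep 2).N × Fin (fundamentalLatticeRep 2).N × Bool => if n.1 = q.1 then (fun z : ℂ => if q.2.2.2 then z.im else z.re) (((Real.sqrt 2 : ℂ) • ((fundamentalLatticeRep 2).lieProj (noiseDir n.2) * (fun (ee : Edge 3 L) => Matrix.of fun (i j : Fin (fundamentalLatticeRep 2).N) => ((coords x (ee, i, j, false) : ℝ) : ℂ) + ((coords x (ee, i, j, true) : ℝ) : ℂ) * Complex.I) q.1)) q.2.1 q.2.2.1) else 0)) τ := by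
  intro coords gen haf haa hgrep hvrep hv₂rep
  refine ⟨continuous_frameDeriv_transitionRep L β' κ hreal hf hfc ha g v hg hv n x haf hgrep hvrep, fun τ hτ => ?_⟩
  have hΨc : Continuous fun σ : ℝ => fderiv ℝ (v σ.toNNReal) (coords x) (fun q : Edge 3 L × Fin (fundamentalLatticeRep 2).N × Fin (fundamentalLatticeRep 2).N × Bool => if n.1 = q.1 then (fun z : ℂ => if q.2.2.2 then z.im else z.re) (((Real.sqrt 2 : ℂ) • ((fundamentalLatticeRep 2).lieProj (noiseDir n.2) * (fun (ee : Edge 3 L) => Matrix.of fun (i j : Fin (fundamentalLatticeRep 2).N) => ((coords x (ee, i, j, false) : ℝ) : ℂ) + ((coords x (ee, i, j, true) : ℝ) : ℂ) * Complex.I) q.1)) q.2.1 q.2.2.1) else 0) :=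
    continuous_frameDeriv_transitionRep L β' κ hreal (ha.of_le (by norm_num)) hac ha₂ v v₂ hv hv₂ n x haa hvrep hv₂rep
  have hFTC : ∀ σ : ℝ, 0 ≤ σ → fderiv ℝ (g σ.toNNReal) (coords x) (fun q : Edge 3 L × Fin (fundamentalLatticeRep 2).N × Fin (fundamentalLatticeRep 2).N × Bool => if n.1 = q.1 then (fun z : ℂ => if q.2.2.2 then z.im else z.re) (((Real.sqrt 2 : ℂ) • ((fundamentalLatticeRep 2).lieProj (noiseDir n.2) * (fun (ee : Edge 3 L) => Matrix.of fun (i j : Fin (fundamentalLatticeRep 2).N) => ((coords x (ee, i, j, false) : ℝ) : ℂ) + ((coords x (ee, i, j, true) : ℝ) : ℂ) * Complex.I) q.1)) q.2.1 q.2.2.1) else 0) =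
      fderiv ℝ (g (0 : ℝ).toNNReal) (coords x) (fun q : Edge 3 L × Fin (fundamentalLatticeRep 2).N × Fin (fundamentalLatticeRep 2).N × Bool => if n.1 = q.1 then (fun z : ℂ => if q.2.2.2 then z.im else z.re) (((Real.sqrt 2 : ℂ) • ((fundamentalLatticeRep 2).lieProj (noiseDir n.2) * (fun (ee : Edge 3 L) => Matrix.of fun (i j : Fin (fundamentalLatticeRep 2).N) => ((coords x (ee, i, j, false) : ℝ) : ℂ) + ((coords x (ee, i, j, true) : ℝ) : ℂ) * Complex.I) q.1)) q.2.1 q.2.2.1) else 0) + ∫ ρ in (0 : ℝ)..σ, fderiv ℝ (v ρ.toNNReal) (coords x) (fun q : Edge 3 L × Fin (fundamentalLatticeRep 2).N × Fin (fundamentalLatticeRep 2).N × Bool => if n.1 = q.1 then (fun z : ℂ => if q.2.2.2 then z.im else z.re) (((Real.sqrt 2 : ℂ) • ((fundamentalLatticeRep 2).lieProj (noiseDir n.2) * (fun (ee : Edge 3 L) => Matrix.of fun (i j : Fin (fundamentalLatticeRep 2).N) => ((coords x (ee, i, j, false) : ℝ) : ℂ) + ((coords x (ee, i, j, true) : ℝ)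 : ℂ) * Complex.I) q.1)) q.2.1 q.2.2.1) else 0) := by
    intro σ hσ
    have hA := (frameDeriv_transition_sub_eq_integral L β' κ hreal hf hfc ha g v hg hv n x le_rfl hσ haf hgrep hvrep).2
    linarith
  have hder : HasDerivAt (fun σ : ℝ => fderiv ℝ (g (0 : ℝ).toNNReal) (coords x) (fun q : Edge 3 L × Fin (fundamentalLatticeRep 2).N × Fin (fundamentalLatticeRep 2).N × Bool => if n.1 = q.1 then (fun z : ℂ => if q.2.2.2 then z.im else z.re) (((Real.sqrt 2 : ℂ) • ((fundamentalLatticeRep 2).lieProj (noiseDir n.2) * (fun (ee : Edge 3 L) => Matrix.of fun (i j : Fin (fundamentalLatticeRep 2).N) => ((coords x (ee, i, j, false) : ℝ) : ℂ) + ((coords x (ee, i, j, true) : ℝ) : ℂ) * Complex.I) q.1)) q.2.1 q.2.2.1) else 0) +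
      ∫ ρ in (0 : ℝ)..σ, fderiv ℝ (v ρ.toNNReal) (coords x) (fun q : Edge 3 L × Fin (fundamentalLatticeRep 2).N × Fin (fundamentalLatticeRep 2).N × Bool => if n.1 = q.1 then (fun z : ℂ => if q.2.2.2 then z.im else z.re) (((Real.sqrt 2 : ℂ) • ((fundamentalLatticeRep 2).lieProj (noiseDir n.2) * (fun (ee : Edge 3 L) => Matrix.of fun (i j : Fin (fundamentalLatticeRep 2).N) => ((coords x (ee, i, j, false) : ℝ) : ℂ) + ((coords x (ee, i, j, true) : ℝ) : ℂ) * Complex.I) q.1)) q.2.1 q.2.2.1) else 0))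
      (fderiv ℝ (v τ.toNNReal) (coords x) (fun q : Edge 3 L × Fin (fundamentalLatticeRep 2).N × Fin (fundamentalLatticeRep 2).N × Bool => if n.1 = q.1 then (fun z : ℂ => if q.2.2.2 then z.im else z.re) (((Real.sqrt 2 : ℂ) • ((fundamentalLatticeRep 2).lieProj (noiseDir n.2) * (fun (ee : Edge 3 L) => Matrix.of fun (i j : Fin (fundamentalLatticeRep 2).N) => ((coords x (ee, i, j, false) : ℝ) : ℂ) + ((coords x (ee, i, j, true) : ℝ) : ℂ) * Complex.I) q.1)) q.2.1 q.2.2.1) else 0)) τ :=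
    ((intervalIntegral.integral_hasDerivAt_right (hΨc.intervalIntegrable _ _)
      (hΨc.stronglyMeasurableAtFilter _ _) hΨc.continuousAt)).const_add _
  refine hder.congr_of_eventuallyEq ?_
  filter_upwards [Ioi_mem_nhds hτ] with σ hσ
  exact hFTC σ (le_of_lt hσ)


end Summit.QuantumFields.YangMills.Theorems.ColdStartUniversality
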